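import Mathlib.Data.Nat.Log
import Literature.Computability.MetaComplexity.Magnification
import Literature.Computability.Complexity.PlumbingBricks
import Literature.Computability.Complexity.TimeBoundsProofs
import Literature.Computability.Complexity.ReductionsProofs
import Literature.Computability.Complexity.TM2PassThrough
import Literature.Computability.Complexity.Classes
import Summits.PneNP.PneNP.Theorems.UniformStreamUniformMagnificationStubSeed
import HarnessLib

/-!
# Route UniformStream, crux `UniformMagnification` (stmt-PneNP-16047), line `registered`,
# stub `stub_wrapperGlue`: the model step (one uniform streaming algorithm from the parts)

**Theorem** (`stub_wrapperGlue`). Assume the linear speed-up for `TM2` machines over `{0,1}`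
(hypothesis `hsp`: every machine is simulated `D` times faster up to the additive overhead
`(|input| + |output|)/D + 3`) and the padded update/accept machines (hypothesis `hpad`: for a
non-lengthening `δ ∈ FP` and `α ∈ P` there are `k, C`, total maps `U`, `acc` computed in
`C |ST| + C` steps, `|U ST b| ≤ max |ST| 2`, and on an adequately padded state `⟨st, 1ᵀ⟩`
(`k (⌊log₂(|st|+1)⌋ + 1) ≤ ⌊log₂(T+1)⌋`) `U ⟨st, 1ᵀ⟩ b = ⟨δ ⟨st, [b]⟩, 1ᵀ⟩` and
`acc ⟨st, 1ᵀ⟩ = [st ∈ α]`). Let `(ι, δ, α)` be a one-pass compressor for `L` from the seed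
`⟨⟨tail (bin N), 1^{s ⌊log₂N⌋}⟩, bin N⟩` (`ι, δ ∈ FP`, `α ∈ P`, `δ` non-lengthening,
`|ι seed| ≤ s(⌊log₂N⌋)^{k₀} + k₀`), and let one machine write the seed from `bin N` within
`s(⌊log₂N⌋)^{c₀} + c₀` steps, where `s n ≥ n`. Then for some `c` ONE streaming algorithm `A` with
three machines (init from `bin N`, update from `⟨st, b⟩`, accept from the final state) decides `L`
with space AND steps `s(⌊log₂N⌋)^c + c`.

Proof (McKay–Murray–Williams 2019, proof of Thm. 1.3, in the tree's machine model).
* `A.init N = ⟨st₀, 1^{T}⟩` with `st₀ = ι seed`, `T = (2|st₀|+2)^k`: the padding map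
  `w ↦ ⟨w, 1^{(2|w|+2)^k}⟩` is `fanoutFn id (Plumb.polyFn ((2X+2)^k)) ∈ FP`, so the init machine
  is the seed machine followed by a polynomial-time machine for `pad ∘ ι`
  (`Turing.TM2ComputableAux.comp_outputsWithin`); its time is polynomial in
  `|seed| ≤ 7 (s n + 1)` (`|bin N| ≤ n + 1`, `n = ⌊log₂ N⌋ ≤ s n`).
* `A.update N = U`, `A.accept N = acc`, computed by the padded machines sped up by
  `D = 2 (C + 5)`: on `⟨ST, b⟩` (length `2|ST|+3`, output length `≤ |ST| + 2`) the sped-up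
  machine halts within `((C+3)|ST| + C + 5) / (2(C+5)) + 3 ≤ (|ST|+1)/2 + 3 ≤ S N` steps
  whenever `|ST| ≤ S N` and `S N ≥ 7`; likewise for the accept machine (output length `1`).
* `HasSpace`: `|U ST b| ≤ max |ST| 2 ≤ S N` and `|A.init N| = 2|st₀| + 2 + (2|st₀|+2)^k` is
  polynomial in `s n`; all polynomial bounds are absorbed into one exponent `c`
  (`mul_succ_pow_add_le_pow_add`, monotonicity of `x^c + c` in `c`), `c ≥ 7`.
* `Decides`: the padding is adequate for every `st` with `|st| ≤ |st₀|`
  (`2^{k(⌊log₂(|st|+1)⌋+1)} ≤ (2(|st₀|+1))^k = T < T + 1`), and `δ` never lengthens a state, so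
  by induction along the input the run of `A` is `⟨run of (ι, δ), 1^T⟩` (`foldl_pad`); then
  `acc` answers `[crun x ∈ α] = [x ∈ L]`.

References: D. M. McKay, C. D. Murray, R. R. Williams, *Weak lower bounds on resource-bounded
compression imply strong separations of complexity classes*, STOC 2019, Thm. 1.3, §4–§5;
S. Arora, B. Barak, *Computational Complexity: A Modern Approach*, CUP 2009, §1.3 (composition
of machines, Claim 1.6; polynomial overheads); J. Hartmanis, R. E. Stearns, *On the
computational complexity of algorithms*, Trans. AMS 117 (1965), Thm. 2 (linear speed-up).
-/

namespace Summit.PneNP.PneNP.Cruxes.UniformMagnification.Birth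

set_option linter.dupNamespace false -- `Summit.PneNP.PneNP.…`: summit = sub-problem (D-0017)

open _root_.Computability Literature.Computability.Complexity
open Literature.Computability.MetaComplexity

namespace WrapperGlue

/-! ### Arithmetic -/

/-- Absorption of the padded initial state: if `m ≤ x^{k₀} + k₀` then
`2m + 2 + (2m+2)^k ≤ x^c + c` for one `c = c(k₀, k)` (`2m + 2 ≤ 2(k₀+2)(x+1)^{k₀} =: w ≥ 1`, so the
left side is at most `2 w^{k+1}`; then `mul_succ_pow_add_le_pow_add`). [folklore] -/
theorem init_len_bound (k₀ k : ℕ) :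
    ∃ c : ℕ, ∀ x m : ℕ, m ≤ x ^ k₀ + k₀ → 2 * m + 2 + (2 * m + 2) ^ k ≤ x ^ c + c := by
  obtain ⟨c, hc⟩ := mul_succ_pow_add_le_pow_add (2 * (2 * (k₀ + 2)) ^ (k + 1)) (k₀ * (k + 1))
  refine ⟨c, fun x m hm => le_trans ?_ (hc x)⟩
  have hz1 : 1 ≤ (x + 1) ^ k₀ := Nat.one_le_pow _ _ (Nat.succ_pos x)
  have hxz : x ^ k₀ ≤ (x + 1) ^ k₀ := Nat.pow_le_pow_left (Nat.le_succ x) k₀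
  have hk : k₀ + 1 ≤ (k₀ + 1) * (x + 1) ^ k₀ := Nat.le_mul_of_pos_right _ hz1
  have hw : 2 * m + 2 ≤ 2 * (k₀ + 2) * (x + 1) ^ k₀ := by nlinarith [hm, hxz, hk]
  have hw1 : 1 ≤ 2 * (k₀ + 2) * (x + 1) ^ k₀ := le_trans (by omega) hw
  have h1 : (2 * m + 2) ^ k ≤ (2 * (k₀ + 2) * (x + 1) ^ k₀) ^ (k + 1) :=
    (Nat.pow_le_pow_left hw k).trans (Nat.pow_le_pow_right hw1 (Nat.le_succ k))
  have h2 : 2 * m + 2 ≤ (2 * (k₀ + 2) * (x + 1) ^ k₀) ^ (k + 1) :=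
    hw.trans (Nat.le_self_pow (Nat.succ_ne_zero k) _)
  have h3 : (2 * (k₀ + 2) * (x + 1) ^ k₀) ^ (k + 1) =
      (2 * (k₀ + 2)) ^ (k + 1) * (x + 1) ^ (k₀ * (k + 1)) := by
    rw [mul_pow, ← pow_mul]
  calc 2 * m + 2 + (2 * m + 2) ^ k
        ≤ (2 * (k₀ + 2) * (x + 1) ^ k₀) ^ (k + 1) + (2 * (k₀ + 2) * (x + 1) ^ k₀) ^ (k + 1) :=
          Nat.add_le_add h2 h1
    _ = 2 * (2 * (k₀ + 2)) ^ (k + 1) * (x + 1) ^ (k₀ * (k + 1)) := by rw [h3]; ring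
    _ ≤ _ := Nat.le_add_right _ _

/-- Absorption of the init machine's running time: if `ℓ ≤ 7 (x + 1)` then
`a ℓ^d + a + (x^{c₀} + c₀) ≤ x^c + c` for one `c = c(a, d, c₀)` (everything is at most a multiple
of `(x+1)^{d + c₀}`; then `mul_succ_pow_add_le_pow_add`). [folklore] -/
theorem seed_time_bound (a d c₀ : ℕ) :
    ∃ c : ℕ, ∀ x ℓ : ℕ, ℓ ≤ 7 * (x + 1) → a * ℓ ^ d + a + (x ^ c₀ + c₀) ≤ x ^ c + c := by
  obtain ⟨c, hc⟩ := mul_succ_pow_add_le_pow_add (a * 7 ^ d + a + 1 + c₀) (d + c₀)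
  refine ⟨c, fun x ℓ hℓ => le_trans ?_ (hc x)⟩
  have hy1 : 1 ≤ (x + 1) ^ (d + c₀) := Nat.one_le_pow _ _ (Nat.succ_pos x)
  have h1 : ℓ ^ d ≤ 7 ^ d * (x + 1) ^ (d + c₀) :=
    calc ℓ ^ d ≤ (7 * (x + 1)) ^ d := Nat.pow_le_pow_left hℓ d
      _ = 7 ^ d * (x + 1) ^ d := mul_pow 7 (x + 1) d
      _ ≤ 7 ^ d * (x + 1) ^ (d + c₀) :=
          Nat.mul_le_mul_left _ (Nat.pow_le_pow_right (Nat.succ_pos x) (Nat.le_add_right d c₀))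
  have h2 : x ^ c₀ ≤ (x + 1) ^ (d + c₀) :=
    (Nat.pow_le_pow_left (Nat.le_succ x) c₀).trans
      (Nat.pow_le_pow_right (Nat.succ_pos x) (Nat.le_add_left c₀ d))
  have h3 := Nat.mul_le_mul_left a h1
  have h4 : a ≤ a * (x + 1) ^ (d + c₀) := Nat.le_mul_of_pos_right _ hy1
  have h5 : c₀ ≤ c₀ * (x + 1) ^ (d + c₀) := Nat.le_mul_of_pos_right _ hy1
  calc a * ℓ ^ d + a + (x ^ c₀ + c₀)
        ≤ a * (7 ^ d * (x + 1) ^ (d + c₀)) + a * (x + 1) ^ (d + c₀) +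
            ((x + 1) ^ (d + c₀) + c₀ * (x + 1) ^ (d + c₀)) :=
          Nat.add_le_add (Nat.add_le_add h3 h4) (Nat.add_le_add h2 h5)
    _ = (a * 7 ^ d + a + 1 + c₀) * (x + 1) ^ (d + c₀) := by ring
    _ ≤ _ := Nat.le_add_right _ _

/-- The sped-up running time fits the budget: a cost `n ≤ C ℓ + C + 3ℓ + 5 ≤ (C+5)(ℓ+1)` divided
by `D = 2(C+5)` is at most `(ℓ+1)/2`, and `(ℓ+1)/2 + 3 ≤ S` for `ℓ ≤ S`, `S ≥ 7`. [folklore] -/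
theorem speedup_time_le {C n ℓ S : ℕ} (hn : n ≤ C * ℓ + C + 3 * ℓ + 5) (hℓ : ℓ ≤ S)
    (hS : 7 ≤ S) : n / ((C + 5) * 2) + 3 ≤ S := by
  have h1 : n ≤ (C + 5) * (ℓ + 1) := by nlinarith [hn]
  have h2 : n / ((C + 5) * 2) ≤ (ℓ + 1) / 2 := by
    have h := Nat.div_le_div_right (c := (C + 5) * 2) h1
    rwa [Nat.mul_div_mul_left _ _ (by omega : 0 < C + 5)] at h
  omega

/-- Adequacy of the padding `T = (2m₀+2)^k` for every state of length `m ≤ m₀`: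
`2^{k(⌊log₂(m+1)⌋+1)} = (2^{⌊log₂(m+1)⌋} · 2)^k ≤ (2(m+1))^k ≤ T < T + 1`. [folklore] -/
theorem adequate_of_le {k m m₀ : ℕ} (h : m ≤ m₀) :
    k * (Nat.log 2 (m + 1) + 1) ≤ Nat.log 2 ((2 * m₀ + 2) ^ k + 1) := by
  refine Nat.le_log_of_pow_le one_lt_two ?_
  calc 2 ^ (k * (Nat.log 2 (m + 1) + 1)) = (2 ^ Nat.log 2 (m + 1) * 2) ^ k := by
        rw [mul_comm, pow_mul, pow_succ]
    _ ≤ ((m + 1) * 2) ^ k :=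
        Nat.pow_le_pow_left
          (Nat.mul_le_mul_right 2 (Nat.pow_log_le_self 2 (Nat.succ_ne_zero m))) k
    _ ≤ (2 * m₀ + 2) ^ k := Nat.pow_le_pow_left (by omega) k
    _ ≤ (2 * m₀ + 2) ^ k + 1 := Nat.le_succ _

/-! ### The run of the padded automaton -/

/-- A non-lengthening transition keeps every state of the run within the initial length.
[folklore] -/
theorem length_foldl_le {δ : List Bool → List Bool}
    (hupd : ∀ (st : List Bool) (b : Bool), (δ (boolPair st [b])).length ≤ st.length) :
    ∀ (p st : List Bool),
      (p.foldl (fun st b => δ (boolPair st [b])) st).length ≤ st.length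
  | [], _ => le_rfl
  | b :: p, st => (length_foldl_le hupd p _).trans (hupd st b)

/-- **The run lemma.** With an adequate padding `1ᵀ` for all states of length `≤ m₀` and a
non-lengthening `δ`, the padded update `U` runs `⟨st, 1ᵀ⟩ ↦ ⟨δ ⟨st, [b]⟩, 1ᵀ⟩` along the whole
input: the padded run is the pairing of the plain run with `1ᵀ` (induction on the input).
[cite: AroraBarakCC2009, §1.3] -/
theorem foldl_pad {U : List Bool → Bool → List Bool} {δ : List Bool → List Bool} {k T m₀ : ℕ}
    (hU : ∀ (st : List Bool) (b : Bool),
      k * (Nat.log 2 (st.length + 1) + 1) ≤ Nat.log 2 (T + 1) →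
        U (boolPair st (List.replicate T true)) b =
          boolPair (δ (boolPair st [b])) (List.replicate T true))
    (hupd : ∀ (st : List Bool) (b : Bool), (δ (boolPair st [b])).length ≤ st.length)
    (hT : ∀ m ≤ m₀, k * (Nat.log 2 (m + 1) + 1) ≤ Nat.log 2 (T + 1)) :
    ∀ (p st : List Bool), st.length ≤ m₀ →
      p.foldl U (boolPair st (List.replicate T true)) =
        boolPair (p.foldl (fun st b => δ (boolPair st [b])) st) (List.replicate T true)
  | [], _, _ => rfl
  | b :: p, st, hst => by
    rw [List.foldl_cons, List.foldl_cons, hU st b (hT _ hst)]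
    exact foldl_pad hU hupd hT p _ ((hupd st b).trans hst)

/-! ### The assembly, for an arbitrary seed word `sd N` -/

/-- **The model step, generic in the seed.** From the speed-up (`hsp`), padded update/accept
machines `P₁, P₂` for `(δ, α)` with their five clauses, a compressor `(ι, δ, α)` deciding `L`
from the seed words `sd N` (`|ι (sd N)| ≤ s(n)^{k₀} + k₀`, `|sd N| ≤ 7 (s n + 1)`, `ι ∈ FP`) and
a seed machine (`s(n)^{c₀} + c₀` steps), ONE streaming algorithm with three machines within the
single budget `s(⌊log₂N⌋)^c + c`: init `= pad ∘ ι ∘ seed`, update `= U`, accept `= acc`, the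
padded machines sped up by `2(C+5)`. [cite: AroraBarakCC2009, §1.3] -/
theorem uStream_of_parts
    (hsp : ∀ (M : Turing.TM2ComputableAux Bool Bool) (D : ℕ), 0 < D →
      ∃ M' : Turing.TM2ComputableAux Bool Bool, ∀ (l l' : List Bool) (m : ℕ),
        M.OutputsWithin l l' m → M'.OutputsWithin l l' ((m + l.length + l'.length) / D + 3))
    {δ : List Bool → List Bool} {α : Language Bool} {k C : ℕ}
    {U : List Bool → Bool → List Bool} {acc : List Bool → Bool}
    {P₁ P₂ : Turing.TM2ComputableAux Bool Bool}
    (hU₁ : ∀ (ST : List Bool) (b : Bool),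
      P₁.OutputsWithin (boolPair ST [b]) (U ST b) (C * ST.length + C))
    (hU₂ : ∀ (ST : List Bool) (b : Bool), (U ST b).length ≤ max ST.length 2)
    (hU₃ : ∀ (st : List Bool) (T : ℕ) (b : Bool),
      k * (Nat.log 2 (st.length + 1) + 1) ≤ Nat.log 2 (T + 1) →
        U (boolPair st (List.replicate T true)) b =
          boolPair (δ (boolPair st [b])) (List.replicate T true))
    (hacc₁ : ∀ ST : List Bool, P₂.OutputsWithin ST (encodeBool (acc ST)) (C * ST.length + C))
    (hacc₂ : ∀ (st : List Bool) (T : ℕ), k * (Nat.log 2 (st.length + 1) + 1) ≤ Nat.log 2 (T + 1) →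
      (acc (boolPair st (List.replicate T true)) = true ↔ st ∈ α))
    (s : ℕ → ℕ) (L : Language Bool) {ι : List Bool → List Bool} (hι : ι ∈ FP)
    (sd : ℕ → List Bool)
    (hdecides : ∀ x : List Bool,
      x.foldl (fun st b => δ (boolPair st [b])) (ι (sd x.length)) ∈ α ↔ x ∈ L)
    {k₀ : ℕ} (hinit : ∀ N : ℕ, (ι (sd N)).length ≤ s (Nat.log 2 N) ^ k₀ + k₀)
    (hupd : ∀ (st : List Bool) (b : Bool), (δ (boolPair st [b])).length ≤ st.length)
    (hsdlen : ∀ N : ℕ, (sd N).length ≤ 7 * (s (Nat.log 2 N) + 1))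
    {c₀ : ℕ} {Mseed : Turing.TM2ComputableAux Bool Bool}
    (hseed : ∀ N : ℕ, Mseed.OutputsWithin (encodeNat N) (sd N) (s (Nat.log 2 N) ^ c₀ + c₀)) :
    ∃ (c : ℕ) (A : StreamingAlgorithm) (M₀ M₁ M₂ : Turing.TM2ComputableAux Bool Bool),
      A.HasSpace (fun N => s (Nat.log 2 N) ^ c + c) ∧
      (∀ N : ℕ, M₀.OutputsWithin (encodeNat N) (A.init N) (s (Nat.log 2 N) ^ c + c)) ∧
      (∀ (N : ℕ) (st : List Bool) (b : Bool), st.length ≤ s (Nat.log 2 N) ^ c + c →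
        M₁.OutputsWithin (boolPair st [b]) (A.update N st b) (s (Nat.log 2 N) ^ c + c)) ∧
      (∀ (N : ℕ) (st : List Bool), st.length ≤ s (Nat.log 2 N) ^ c + c →
        M₂.OutputsWithin st (encodeBool (A.accept N st)) (s (Nat.log 2 N) ^ c + c)) ∧
      A.Decides L := by
  -- the padded machines, sped up by `D = 2 (C + 5)`
  obtain ⟨M₁, hM₁⟩ := hsp P₁ ((C + 5) * 2) (by positivity)
  obtain ⟨M₂, hM₂⟩ := hsp P₂ ((C + 5) * 2) (by positivity)
  -- the padding map `w ↦ ⟨w, 1^{(2|w|+2)^k}⟩ ∈ FP` and the init machine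
  obtain ⟨Q, hQ⟩ : ∃ Q : Polynomial ℕ, ∀ m : ℕ, Q.eval m = (2 * m + 2) ^ k :=
    ⟨(Polynomial.C 2 * Polynomial.X + Polynomial.C 2) ^ k, fun m => by simp⟩
  obtain ⟨ι', hι', hι'FP⟩ : ∃ ι' : List Bool → List Bool,
      (∀ w, ι' w = boolPair (ι w) (List.replicate ((2 * (ι w).length + 2) ^ k) true)) ∧
        ι' ∈ FP :=
    ⟨fanoutFn id (Plumb.polyFn Q) ∘ ι, fun w => by simp [hQ],
      comp_mem_FP (fanoutFn_mem_FP OracleCompose.id_mem_FP (Plumb.polyFn_mem_FP Q)) hι⟩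
  obtain ⟨p, Mι, hMι⟩ := hι'FP
  obtain ⟨a, d, hp⟩ := exists_eval_le_mul_pow_add p
  -- the budget exponent
  obtain ⟨c₁, hc₁⟩ := init_len_bound k₀ k
  obtain ⟨c₂, hc₂⟩ := seed_time_bound a d c₀
  -- the budget `x^c + c` is monotone in `c` (also at `x = 0`)
  have hmono : ∀ {e₁ e₂ : ℕ}, e₁ ≤ e₂ → ∀ x : ℕ, x ^ e₁ + e₁ ≤ x ^ e₂ + e₂ := by
    intro e₁ e₂ h x
    rcases Nat.eq_zero_or_pos x with rfl | hx
    · rcases Nat.eq_zero_or_pos e₁ with rfl | he₁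
      · rcases Nat.eq_zero_or_pos e₂ with rfl | he₂
        · exact le_rfl
        · rw [zero_pow he₂.ne', pow_zero]; omega
      · rw [zero_pow he₁.ne', zero_pow (by omega : e₂ ≠ 0)]; omega
    · exact Nat.add_le_add (Nat.pow_le_pow_right hx h) h
  have hS₁ : ∀ x, x ^ c₁ + c₁ ≤ x ^ (c₁ + c₂ + 7) + (c₁ + c₂ + 7) := hmono (by omega)
  have hS₂ : ∀ x, x ^ c₂ + c₂ ≤ x ^ (c₁ + c₂ + 7) + (c₁ + c₂ + 7) := hmono (by omega)
  have hS7 : ∀ x, 7 ≤ x ^ (c₁ + c₂ + 7) + (c₁ + c₂ + 7) :=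
    fun x => (show 7 ≤ c₁ + c₂ + 7 by omega).trans (Nat.le_add_left _ _)
  refine ⟨c₁ + c₂ + 7, ⟨fun N => ι' (sd N), fun _ => U, fun _ => acc⟩, Mseed.comp Mι, M₁, M₂,
    fun N => ⟨?_, fun st b hst => ?_⟩, fun N => ?_, fun N st b hst => ?_, fun N st hst => ?_,
    fun x => ?_⟩
  · -- space: the initial state
    show (ι' (sd N)).length ≤ _
    rw [hι', length_boolPair, List.length_replicate]
    exact (hc₁ _ _ (hinit N)).trans (hS₁ _)
  · -- space: the update
    show (U st b).length ≤ _
    exact (hU₂ st b).trans (max_le hst ((show 2 ≤ 7 by norm_num).trans (hS7 _)))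
  · -- the init machine: seed, then `pad ∘ ι`
    show (Mseed.comp Mι).OutputsWithin (encodeNat N) (ι' (sd N)) _
    refine (Turing.TM2ComputableAux.comp_outputsWithin _ _ (hseed N) (hMι (sd N))).mono ?_
    show p.eval (sd N).length + (s (Nat.log 2 N) ^ c₀ + c₀) ≤ _
    exact (Nat.add_le_add_right (hp _) _).trans ((hc₂ _ _ (hsdlen N)).trans (hS₂ _))
  · -- the update machine
    show M₁.OutputsWithin (boolPair st [b]) (U st b) _
    refine (hM₁ _ _ _ (hU₁ st b)).mono (speedup_time_le ?_ hst (hS7 _))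
    have h := hU₂ st b
    rw [length_boolPair, List.length_singleton]
    omega
  · -- the accept machine
    show M₂.OutputsWithin st (encodeBool (acc st)) _
    refine (hM₂ _ _ _ (hacc₁ st)).mono (speedup_time_le ?_ hst (hS7 _))
    have h : (encodeBool (acc st)).length = 1 := rfl
    rw [h]
    omega
  · -- correctness: the padded run is the pairing of the compressor's run with the padding
    show acc (List.foldl U (ι' (sd x.length)) x) = true ↔ x ∈ L
    have hrun := foldl_pad (U := U) (T := (2 * (ι (sd x.length)).length + 2) ^ k)
      (m₀ := (ι (sd x.length)).length) (fun st b h => hU₃ st _ b h) hupd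
      (fun m hm => adequate_of_le hm) x (ι (sd x.length)) le_rfl
    rw [hι', hrun, hacc₂ _ _ (adequate_of_le (length_foldl_le hupd x (ι (sd x.length))))]
    exact hdecides x

end WrapperGlue

open WrapperGlue in
/-- **`stub_wrapperGlue`** — the model step assembled (`SpeedupSpec → PadUpdateSpec → WrapperSpec s`
for `s n ≥ n`, all unfolded): `A.init N = ⟨ι seed, 1^{T_N}⟩` with `T_N = (2 m₀ + 2)^k`,
`m₀ = |ι seed|` (the padding map `fanoutFn id (Plumb.polyFn ((2X+2)^k))` is in `FP`, so
`M₀ = seed machine ; M_{pad ∘ ι}`), `A.update N = U`, `A.accept N = acc`, `M₁, M₂` the padded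
machines sped up by `D = 2(C+5)` (time `≤ (|ST|+1)/2 + 3 ≤ S N` once `S N ≥ 7`); `HasSpace` from
`|U ST b| ≤ max |ST| 2` and `|A.init N| = poly(s n)`; `Decides`: the final state is
`⟨crun x, 1^{T_N}⟩` by induction (adequacy is monotone in `|st| ≤ m₀`, `δ` non-lengthening), then
the compressor decides; `c` absorbs all polynomial bounds. [cite: AroraBarakCC2009, §1.3] -/
theorem stub_wrapperGlue
    (hsp : ∀ (M : Turing.TM2ComputableAux Bool Bool) (D : ℕ), 0 < D →
      ∃ M' : Turing.TM2ComputableAux Bool Bool, ∀ (l l' : List Bool) (m : ℕ),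
        M.OutputsWithin l l' m → M'.OutputsWithin l l' ((m + l.length + l'.length) / D + 3))
    (hpad : ∀ (δ : List Bool → List Bool) (α : Language Bool), δ ∈ FP → α ∈ Classes.P →
      (∀ (st : List Bool) (b : Bool), (δ (boolPair st [b])).length ≤ st.length) →
      ∃ (k C : ℕ) (U : List Bool → Bool → List Bool) (acc : List Bool → Bool)
        (M₁ M₂ : Turing.TM2ComputableAux Bool Bool),
        (∀ (ST : List Bool) (b : Bool), M₁.OutputsWithin (boolPair ST [b]) (U ST b) (C * ST.length + C)) ∧
        (∀ (ST : List Bool) (b : Bool), (U ST b).length ≤ max ST.length 2) ∧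
        (∀ (st : List Bool) (T : ℕ) (b : Bool),
            k * (Nat.log 2 (st.length + 1) + 1) ≤ Nat.log 2 (T + 1) →
            U (boolPair st (List.replicate T true)) b =
              boolPair (δ (boolPair st [b])) (List.replicate T true)) ∧
        (∀ ST : List Bool, M₂.OutputsWithin ST (encodeBool (acc ST)) (C * ST.length + C)) ∧
        (∀ (st : List Bool) (T : ℕ), k * (Nat.log 2 (st.length + 1) + 1) ≤ Nat.log 2 (T + 1) →
            (acc (boolPair st (List.replicate T true)) = true ↔ st ∈ α)))
    (s : ℕ → ℕ) (hs : ∀ n, n ≤ s n)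
    (L : Language Bool) (ι δ : List Bool → List Bool) (α : Language Bool)
    (hdecides : ∀ x : List Bool,
      x.foldl (fun st b => δ (boolPair st [b]))
          (ι (boolPair (boolPair (encodeNat x.length).tail
            (List.replicate (s (Nat.log 2 x.length)) true)) (encodeNat x.length))) ∈ α ↔ x ∈ L)
    (hinit : ∃ k : ℕ, ∀ N : ℕ,
      (ι (boolPair (boolPair (encodeNat N).tail (List.replicate (s (Nat.log 2 N)) true))
        (encodeNat N))).length ≤ s (Nat.log 2 N) ^ k + k)
    (hupd : ∀ (st : List Bool) (b : Bool), (δ (boolPair st [b])).length ≤ st.length)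
    (hι : ι ∈ FP) (hδ : δ ∈ FP) (hα : α ∈ Classes.P)
    (hseed : ∃ (c : ℕ) (M : Turing.TM2ComputableAux Bool Bool), ∀ N : ℕ,
      M.OutputsWithin (encodeNat N)
        (boolPair (boolPair (encodeNat N).tail (List.replicate (s (Nat.log 2 N)) true)) (encodeNat N))
        (s (Nat.log 2 N) ^ c + c)) :
    ∃ (c : ℕ) (A : StreamingAlgorithm) (M₀ M₁ M₂ : Turing.TM2ComputableAux Bool Bool),
      A.HasSpace (fun N => s (Nat.log 2 N) ^ c + c) ∧
      (∀ N : ℕ, M₀.OutputsWithin (encodeNat N) (A.init N) (s (Nat.log 2 N) ^ c + c)) ∧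
      (∀ (N : ℕ) (st : List Bool) (b : Bool), st.length ≤ s (Nat.log 2 N) ^ c + c →
        M₁.OutputsWithin (boolPair st [b]) (A.update N st b) (s (Nat.log 2 N) ^ c + c)) ∧
      (∀ (N : ℕ) (st : List Bool), st.length ≤ s (Nat.log 2 N) ^ c + c →
        M₂.OutputsWithin st (encodeBool (A.accept N st)) (s (Nat.log 2 N) ^ c + c)) ∧
      A.Decides L := by
  obtain ⟨k, C, U, acc, P₁, P₂, hU₁, hU₂, hU₃, hacc₁, hacc₂⟩ := hpad δ α hδ hα hupd
  obtain ⟨k₀, hk₀⟩ := hinit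
  obtain ⟨c₀, Mseed, hMseed⟩ := hseed
  have hsdlen : ∀ N : ℕ,
      (boolPair (boolPair (encodeNat N).tail (List.replicate (s (Nat.log 2 N)) true))
        (encodeNat N)).length ≤ 7 * (s (Nat.log 2 N) + 1) := by
    intro N
    have h1 := TM2Pass.length_encodeNat_le N
    have h2 := hs (Nat.log 2 N)
    simp only [length_boolPair, List.length_replicate, length_tail_encodeNat]
    omega
  exact uStream_of_parts hsp hU₁ hU₂ hU₃ hacc₁ hacc₂ s L hι
    (fun N => boolPair (boolPair (encodeNat N).tail (List.replicate (s (Nat.log 2 N)) true))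
      (encodeNat N))
    hdecides hk₀ hupd hsdlen hMseed

end Summit.PneNP.PneNP.Cruxes.UniformMagnification.Birth
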